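import Summits.HodgeConjecture.CorCM.MultiFieldWeilDihedralUnit
import HarnessLib

/-!
# MULTI-FIELD WEIL ENGINE — THE DIHEDRAL UNIT WITH FIELD-LEVEL FREENESS: the separation property `hunit` of a dihedral decic unit of ANY menu (general slot sizes, units the fibres
# of the index map), from the closure degree `≤ 20`, an outside value, and freeness stated on automorphisms of `ℂ` (census ∕ realised level)

Cell `pub-hodgecm2` (COR-CM), seat b30 gen 43 (2026-08-26); count-neutral own lane MULTI-FIELD WEIL ENGINE (stem `MultiFieldWeil*`).  The block «freeness, read on the realised
tuples» of `CorCM/MultiFieldWeilDihedralDecics.lean` (gen 42, written inline there three times for the constant slot size `5`) as ONE lemma for a menu with slots of SEVERAL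
sizes `n m` (sextic ∕ octic ∕ decic): the unit of the slot `m` (the slots `m'` with `U m' = U m`, i.e. over the same field, `n m = 5`) reads its position sets through the casts
`Fin (n m') → Fin (n m)`, the realised tuples are diagonal on the unit, and the field-level FREENESS (an automorphism of `ℂ` over `τ(k)` stabilising, on the `τ`-embeddings, the
type of every structure over the field fixes every `τ`-embedding) gives the realised freeness needed by `const_of_signed_realisedTuples_of_dihedral` (E5b).  Used by the merged
units menu `CorCM/MultiFieldWeilUnitsMenuAllKinds.lean`.  Theorems only; no definition, no named fact, no `sorry`.  HONEST FRAMING: field arithmetic ∕ finite combinatorics;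
`HC_CM` is NOT touched.
[cite: Shimura1998, §18.2 Lemma (i)] [cite: DixonMortimer1996, §1.4 Ex. 1.4.1–1.4.2; §1.6, Thm. 1.6A; §3.3] [cite: Serre1977, §5.3] [cite: Lang2002, VI §1 Thm. 1.1; XIII §4]

## References
* [Shimura1998] G. Shimura, *Abelian varieties with complex multiplication and modular functions*, §18.2.  [DixonMortimer1996] J. D. Dixon, B. Mortimer, *Permutation Groups*,
  GTM 163.  [Serre1977] J.-P. Serre, *Linear Representations of Finite Groups*, GTM 42, §5.3.  [Lang2002] S. Lang, *Algebra*, GTM 211, VI §1, XIII §4.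
-/

noncomputable section

open NumberField IntermediateField

namespace Summit.HodgeConjecture.CorCM.MultiFieldWeil

open Finset
open Literature.AlgebraicGeometry.Motives (CMType)
open Literature.NumberTheory.ComplexMultiplication
open Summit.HodgeConjecture.CorCM.Census.MultiFieldWeil

open scoped Classical

section Realised

variable {I : Type} {r : ℕ} {Kf : I → Type} [∀ i, Field (Kf i)] [∀ i, NumberField (Kf i)] {i₀ : I} {is : Fin r → I} {n : Fin r → ℕ}
  {e : ∀ m : Fin r, (Kf (is m) →+* ℂ) ≃ Fin (n m) × Bool} {τ : Kf i₀ →+* ℂ} {im : ∀ m : Fin r, Kf i₀ →+* Kf (is m)}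
  (he_sign : ∀ (m : Fin r) (s : Kf (is m) →+* ℂ), (e m s).2 = true ↔ s.comp (im m) = τ)

include he_sign in
/-- **THE SEPARATION PROPERTY OF A DIHEDRAL DECIC UNIT FROM FIELD-LEVEL FREENESS.**  Slots `is : Fin r → I` with sign frames `e m` of sizes `n m`, types `Ψ m` read at
position sets `P m`; units = the fibres of `U` = the fibres of `is`, one size and diagonal realised tuples inside a unit.  For a slot `m` with `n m = 5`, at most two slots in its
unit, position sets of size `2`, Galois closure of `K_{is m}` of degree `≤ 20`, a `τ`-embedding value outside the field generated by another, and FREENESS at the field level,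
every solution of the unit's signed equations over the realised tuples is constant — the hypothesis `hunit` of the separated engines at this unit.
[cite: Shimura1998, §18.2 Lemma (i)] [cite: DixonMortimer1996, §1.4 Ex. 1.4.1–1.4.2; §1.6, Thm. 1.6A; §3.3] [cite: Serre1977, §5.3] -/
theorem unit_separated_of_dihedral_free (h2 : Module.finrank ℚ (Kf i₀) = 2) (Ψ : ∀ m : Fin r, CMType (Kf (is m))) (P : ∀ m : Fin r, Finset (Fin (n m)))
    (hΨ : ∀ (m : Fin r) (s : Kf (is m) →+* ℂ), s ∈ (Ψ m).1 ↔ (e m s).2 = decide ((e m s).1 ∈ P m))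
    (U : Fin r → Fin r) (hU : ∀ m m' : Fin r, U m' = U m ↔ is m' = is m) (hn : ∀ m m' : Fin r, U m' = U m → n m' = n m)
    (hdg : ∀ π ∈ realisedTuples e τ, ∀ (m m' : Fin r) (h : U m' = U m) (a : Fin (n m')), Fin.cast (hn m m' h) (π m' a) = π m (Fin.cast (hn m m' h) a))
    (m : Fin r) (h5 : n m = 5) (hcard : ∀ m', U m' = U m → (P m').card = 2) (hι : Fintype.card {m' : Fin r // U m' = U m} ≤ 2)
    (h20 : Module.finrank ℚ ↥(normalClosure ℚ (Kf (is m)) ℂ) ≤ 20)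
    (hns : ∃ s₀ t₀ : Kf (is m) →+* ℂ, s₀.comp (im m) = τ ∧ t₀.comp (im m) = τ ∧ ∃ x, t₀ x ∉ adjoin ℚ (Set.range s₀))
    (hfree : ∀ ρ : ℂ ≃+* ℂ, (ρ : ℂ →+* ℂ).comp τ = τ →
      (∀ m', is m' = is m → ∀ s : Kf (is m') →+* ℂ, s.comp (im m') = τ → (s ∈ (Ψ m').1 ↔ (ρ : ℂ →+* ℂ).comp s ∈ (Ψ m').1)) →
      ∀ s : Kf (is m) →+* ℂ, s.comp (im m) = τ → (ρ : ℂ →+* ℂ).comp s = s)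
    (u : {m' : Fin r // U m' = U m} → Fin (n m) → ℤ) (w : ℤ)
    (hw : ∀ π ∈ realisedTuples e τ, (∑ i, ∑ x : Fin (n m), (if π m x ∈ (P i.1).image (Fin.cast (hn m i.1 i.2)) then u i x else -u i x)) = w)
    (i : {m' : Fin r // U m' = U m}) (a b : Fin (n m)) : u i a = u i b := by
  -- readings through the frames
  have hmemP : ∀ (m' : Fin r) (x : Fin (n m')), x ∈ P m' ↔ (e m').symm (x, true) ∈ (Ψ m').1 := fun m' x => by
    rw [hΨ m', Equiv.apply_symm_apply, true_eq_decide_iff]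
  have hsymm_sign : ∀ (m' : Fin r) (x : Fin (n m')), ((e m').symm (x, true)).comp (im m') = τ := fun m' x =>
    (he_sign m' _).1 (by rw [Equiv.apply_symm_apply])
  have hQcard : ∀ i : {m' : Fin r // U m' = U m}, ((P i.1).image (Fin.cast (hn m i.1 i.2))).card = 2 := fun i => by
    rw [Finset.card_image_of_injective _ (Fin.cast_injective _), hcard i.1 i.2]
  -- freeness, read on the realised tuples
  have hfreeR : ∀ π ∈ realisedTuples e τ, (∀ (i : {m' : Fin r // U m' = U m}) (y : Fin (n m)), π m y ∈ (P i.1).image (Fin.cast (hn m i.1 i.2)) ↔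
      y ∈ (P i.1).image (Fin.cast (hn m i.1 i.2))) → π m = 1 := by
    intro π hπ hst
    obtain ⟨ρ, hρτ, hρ⟩ := (mem_realisedTuples e τ π).1 hπ
    have hfix := hfree ρ hρτ (fun m' hm' s hs => by
      have hUm' : U m' = U m := (hU m m').2 hm'
      set x : Fin (n m') := (e m' s).1 with hx
      have hs' : (e m').symm (x, true) = s := by
        rw [hx, show ((e m' s).1, true) = e m' s from Prod.ext rfl ((he_sign m' s).2 hs).symm, Equiv.symm_apply_apply]
      have hρs : (ρ : ℂ →+* ℂ).comp s = (e m').symm (π m' x, true) := by rw [← hs']; exact hρ m' x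
      have h1 : s ∈ (Ψ m').1 ↔ x ∈ P m' := by rw [hmemP, hs']
      have h2' : (ρ : ℂ →+* ℂ).comp s ∈ (Ψ m').1 ↔ π m' x ∈ P m' := by rw [hmemP, hρs]
      rw [h1, h2']
      have hy := hst ⟨m', hUm'⟩ (Fin.cast (hn m m' hUm') x)
      rw [← hdg π hπ m m' hUm' x, (Fin.cast_injective _).mem_finset_image, (Fin.cast_injective _).mem_finset_image] at hy
      exact hy.symm)
    refine Equiv.ext fun y => ?_
    have hy := hfix ((e m).symm (y, true)) (hsymm_sign m y)
    rw [hρ m y] at hy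
    exact congrArg Prod.fst ((e m).symm.injective hy)
  exact const_of_signed_realisedTuples_of_dihedral (e := e) he_sign m h5 h2 h20 hns hι
    (fun i => (P i.1).image (Fin.cast (hn m i.1 i.2))) hQcard hfreeR u hw i a b

end Realised

end Summit.HodgeConjecture.CorCM.MultiFieldWeil

end
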